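import Summits.QuantumAdvantage.AdviceFreeQNC0.AffBells33FibreDichotomy
import Summits.QuantumAdvantage.AdviceFreeQNC0.AffBells35Fibres
import HarnessLib

/-!
# AffBells36 — the COMMON-MODE STEP identities (qa-qnc0-p1 g36, support for `stmt-QuantumAdvantage-22907`, rung NP₁)

STATUS: support lemmas (flip calculus without a free coin), sorry-free.  WHAT THIS IS NOT: no crux closed; separation NOT moved.

ROUND-34/35's flip lemmas (`windowFlip_count`, `privateCoinLemma`, `twinBlock`, … in `exp35/WREL35.lean`) all use a FREE coin
(read by no active row) as the parity partner.  Inside a macroscopic wire no coin is free.  The replacement is the COMMON-MODE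
flip: set two off coins `u, v` on simultaneously (the input stays on the fibre and keeps its parity class); every row's test sum
moves by `P b u + P b v`.  Comparing two such flips whose shifts AGREE on all rows outside a set `G` isolates `G`:

* `commonStep_count` — if `P b t₁ + P b t₂ = P b t₃ + P b t₄` for all `b ∉ G`, then on a perfect fibre, at every admissible base
  point, `#{g ∈ G : s_g + (P g t₁ + P g t₂) = r_g} ≡ #{g ∈ G : s_g + (P g t₃ + P g t₄) = r_g}  (mod 2)`;
* `doubleStep` — `G = {g}` with the two shifts different at `g` and `g` passing after the first shift: contradiction.  This is the
  engine of «SCATTERED WIRES DIE»: if consecutive rows of a wire acquire ≥ 2 new coins per step with proportional coefficients, the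
  row between two acquisitions is isolated, so surviving wires are UNIT-STEP (ROUND-35 memo §3);
* `twinClass_balance` — `G` a class of fibre-twins below the upper pair: its residue multiset is shift-balanced;
* `doubleStep_fibre` — the game-level wrapper (`PerfectFibre β c (kline x)`, coins `i₁ … i₄` of `x`, signed coefficients `sdelta`).

Ported to the tree verbatim by the prover seat qn-prover-3 g20 (ask of planner qa-qnc0-p1 g36, ROUND-35 §6 / P-36d; `HOME/qa-qnc0-p1/exp36/Steps36.lean`,
farm rc 0 / 0 sorry / 0 warn); serves stmt-QuantumAdvantage-22907 (untagged: the gate refuses `--supports` across sub-problems).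
-/

noncomputable section

open Classical

namespace Summit.QuantumAdvantage.AdviceFreeQNC0.AffBells36

open Finset Literature.Computability.QuantumComplexity Literature.Computability.QuantumComplexity.RingHLF
open AffBells23 Fib19 AffBells26 AffBells28 AffBells28lit AffBells33 AffBells35

section CommonStep

variable {Z K : ℕ}

/-- the test sum of row `b` at the cube point `y`. -/
def tsum (P : Fin K → Fin Z → ZMod 3) (y : Fin Z → Bool) (b : Fin K) : ZMod 3 := ∑ t, if y t then P b t else 0

/-- `testCount_eq` (planner qa-qnc0-p1 g36, exp36/Steps36.lean). -/
theorem testCount_eq (P : Fin K → Fin Z → ZMod 3) (r : Fin K → ZMod 3) (τ : ℕ) (y : Fin Z → Bool) :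
    testCount P r τ y = τ + (univ.filter fun b => tsum P y b = r b).card := rfl

/-- the COMMON-MODE flip: set the two (off) coins `u, v` on. -/
def pairUp (u v : Fin Z) (y : Fin Z → Bool) : Fin Z → Bool := fun t => if t = u ∨ t = v then true else y t

/-- `onesCard_pairUp` (planner qa-qnc0-p1 g36, exp36/Steps36.lean). -/
theorem onesCard_pairUp {u v : Fin Z} (huv : u ≠ v) (y : Fin Z → Bool) (hu : y u = false) (hv : y v = false) :
    onesCard (pairUp u v y) = onesCard y + 2 := by
  unfold onesCard
  have hset : (univ.filter fun i => pairUp u v y i = true) = insert u (insert v (univ.filter fun i => y i = true)) := by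
    ext t
    simp only [mem_filter, mem_univ, true_and, mem_insert, pairUp]
    by_cases h1 : t = u
    · subst h1; simp
    · by_cases h2 : t = v
      · subst h2; simp
      · simp [h1, h2]
  rw [hset, card_insert_of_notMem, card_insert_of_notMem]
  · simp [hv]
  · simp [huv, hu]

/-- `onesCard_pairUp_mod` (planner qa-qnc0-p1 g36, exp36/Steps36.lean). -/
theorem onesCard_pairUp_mod {u v : Fin Z} (huv : u ≠ v) (y : Fin Z → Bool) (hu : y u = false) (hv : y v = false)
    (hy : onesCard y % 2 = 0) : onesCard (pairUp u v y) % 2 = 0 := by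
  rw [onesCard_pairUp huv y hu hv]; omega

/-- `tsum_pairUp` (planner qa-qnc0-p1 g36, exp36/Steps36.lean). -/
theorem tsum_pairUp (P : Fin K → Fin Z → ZMod 3) {u v : Fin Z} (huv : u ≠ v) (y : Fin Z → Bool)
    (hu : y u = false) (hv : y v = false) (b : Fin K) :
    tsum P (pairUp u v y) b = tsum P y b + (P b u + P b v) := by
  unfold tsum
  have key : ∀ t, (if pairUp u v y t then P b t else 0) =
      (if y t then P b t else 0) + ((if t = u then P b u else 0) + (if t = v then P b v else 0)) := by
    intro t
    unfold pairUp
    by_cases h1 : t = u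
    · subst h1; simp [hu, huv]
    · by_cases h2 : t = v
      · subst h2; simp [hv, h1]
      · simp [h1, h2]
  simp_rw [key]
  rw [sum_add_distrib, sum_add_distrib, sum_ite_eq', sum_ite_eq']
  simp

/-- **COMMON-STEP COUNT IDENTITY.**  Two common-mode flips whose shifts agree outside `G` isolate `G` (mod 2). -/
theorem commonStep_count (P : Fin K → Fin Z → ZMod 3) (r : Fin K → ZMod 3) (τ : ℕ) {t₁ t₂ t₃ t₄ : Fin Z}
    (h12 : t₁ ≠ t₂) (h34 : t₃ ≠ t₄) (G : Finset (Fin K))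
    (hU : ∀ b, b ∉ G → P b t₁ + P b t₂ = P b t₃ + P b t₄)
    (hperf : ∀ y : Fin Z → Bool, onesCard y % 2 = 0 → testCount P r τ y % 2 = 0)
    (y : Fin Z → Bool) (hy : onesCard y % 2 = 0)
    (hy1 : y t₁ = false) (hy2 : y t₂ = false) (hy3 : y t₃ = false) (hy4 : y t₄ = false) :
    (G.filter fun g => tsum P y g + (P g t₁ + P g t₂) = r g).card % 2 =
      (G.filter fun g => tsum P y g + (P g t₃ + P g t₄) = r g).card % 2 := by
  have hA := hperf _ (onesCard_pairUp_mod h12 y hy1 hy2 hy)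
  have hB := hperf _ (onesCard_pairUp_mod h34 y hy3 hy4 hy)
  rw [testCount_eq] at hA hB
  have eA : (univ.filter fun b => tsum P (pairUp t₁ t₂ y) b = r b) =
      univ.filter fun b => tsum P y b + (P b t₁ + P b t₂) = r b := by
    ext b; simp only [mem_filter, mem_univ, true_and, tsum_pairUp P h12 y hy1 hy2]
  have eB : (univ.filter fun b => tsum P (pairUp t₃ t₄ y) b = r b) =
      univ.filter fun b => tsum P y b + (P b t₃ + P b t₄) = r b := by
    ext b; simp only [mem_filter, mem_univ, true_and, tsum_pairUp P h34 y hy3 hy4]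
  rw [eA] at hA
  rw [eB] at hB
  -- split both counts along membership in `G`
  have hsplit : ∀ Q : Fin K → Prop, [DecidablePred Q] →
      (univ.filter fun b => Q b).card = (G.filter fun b => Q b).card + (univ.filter fun b => b ∉ G ∧ Q b).card := by
    intro Q _
    rw [← card_filter_add_card_filter_not (p := fun b => b ∈ G), filter_filter, filter_filter]
    congr 1
    · congr 1; ext b; simp [and_comm]
    · congr 1; ext b; simp [and_comm]
  rw [hsplit] at hA hB
  have hsame : (univ.filter fun b => b ∉ G ∧ tsum P y b + (P b t₁ + P b t₂) = r b) =
      univ.filter fun b => b ∉ G ∧ tsum P y b + (P b t₃ + P b t₄) = r b := by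
    ext b
    simp only [mem_filter, mem_univ, true_and]
    constructor
    · rintro ⟨hb, h⟩; exact ⟨hb, by rw [← hU b hb]; exact h⟩
    · rintro ⟨hb, h⟩; exact ⟨hb, by rw [hU b hb]; exact h⟩
  rw [hsame] at hA
  have e1 : (G.filter fun b => tsum P y b + (P b t₁ + P b t₂) = r b) =
      G.filter fun g => tsum P y g + (P g t₁ + P g t₂) = r g := rfl
  omega

/-- **DOUBLE-STEP LEMMA.**  A single row isolated between two common-mode flips cannot pass: if the two shifts agree on every other
row and differ at `g`, then `g` fails at every admissible base point after the first shift.  (With `P g t₃ = P g t₄ = 0` — `g` does not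
read the upper pair — this says the test of `g` never passes at base points shifted by `P g t₁ + P g t₂ ≠ 0`; choosing the base point
with `s_g = r_g − (P g t₁ + P g t₂)` gives the contradiction.) -/
theorem doubleStep (P : Fin K → Fin Z → ZMod 3) (r : Fin K → ZMod 3) (τ : ℕ) {t₁ t₂ t₃ t₄ : Fin Z}
    (h12 : t₁ ≠ t₂) (h34 : t₃ ≠ t₄) (g : Fin K)
    (hU : ∀ b, b ≠ g → P b t₁ + P b t₂ = P b t₃ + P b t₄) (hne : P g t₁ + P g t₂ ≠ P g t₃ + P g t₄)
    (hperf : ∀ y : Fin Z → Bool, onesCard y % 2 = 0 → testCount P r τ y % 2 = 0)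
    (y : Fin Z → Bool) (hy : onesCard y % 2 = 0)
    (hy1 : y t₁ = false) (hy2 : y t₂ = false) (hy3 : y t₃ = false) (hy4 : y t₄ = false)
    (hpass : tsum P y g + (P g t₁ + P g t₂) = r g) : False := by
  have h := commonStep_count P r τ h12 h34 {g} (fun b hb => hU b (by simpa using hb)) hperf y hy hy1 hy2 hy3 hy4
  rw [filter_singleton, filter_singleton, if_pos hpass] at h
  have hfail : ¬ (tsum P y g + (P g t₃ + P g t₄) = r g) := by
    intro h'
    apply hne
    have := hpass.trans h'.symm
    exact add_left_cancel this
  rw [if_neg hfail] at h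
  simp at h

/-- **TWIN-CLASS BALANCE.**  A class `G` of fibre-twins (equal test coefficients) that does not read the upper pair and is isolated by
the two flips has a SHIFT-BALANCED residue count at every admissible base point: `#{g ∈ G : r_g = s + κ} ≡ #{g ∈ G : r_g = s}` where
`s` is the common test sum and `κ = P g₀ t₁ + P g₀ t₂` the common shift.  (So `κ ≠ 0` forces `n_s ≡ n_{s+κ} ≡ n_{s+2κ}`: a class with
one active member is impossible, and thin wires need near-by hosts.) -/
theorem twinClass_balance (P : Fin K → Fin Z → ZMod 3) (r : Fin K → ZMod 3) (τ : ℕ) {t₁ t₂ t₃ t₄ : Fin Z}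
    (h12 : t₁ ≠ t₂) (h34 : t₃ ≠ t₄) (G : Finset (Fin K)) (g₀ : Fin K)
    (htwin : ∀ g ∈ G, ∀ t, P g t = P g₀ t) (hup : P g₀ t₃ + P g₀ t₄ = 0)
    (hU : ∀ b, b ∉ G → P b t₁ + P b t₂ = P b t₃ + P b t₄)
    (hperf : ∀ y : Fin Z → Bool, onesCard y % 2 = 0 → testCount P r τ y % 2 = 0)
    (y : Fin Z → Bool) (hy : onesCard y % 2 = 0)
    (hy1 : y t₁ = false) (hy2 : y t₂ = false) (hy3 : y t₃ = false) (hy4 : y t₄ = false) :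
    (G.filter fun g => r g = tsum P y g₀ + (P g₀ t₁ + P g₀ t₂)).card % 2 =
      (G.filter fun g => r g = tsum P y g₀).card % 2 := by
  have h := commonStep_count P r τ h12 h34 G hU hperf y hy hy1 hy2 hy3 hy4
  have hts : ∀ g ∈ G, tsum P y g = tsum P y g₀ := by
    intro g hg; unfold tsum; exact sum_congr rfl fun t _ => by rw [htwin g hg t]
  have e1 : (G.filter fun g => tsum P y g + (P g t₁ + P g t₂) = r g) =
      G.filter fun g => r g = tsum P y g₀ + (P g₀ t₁ + P g₀ t₂) := by
    apply filter_congr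
    intro g hg
    rw [hts g hg, htwin g hg t₁, htwin g hg t₂]
    exact eq_comm
  have e2 : (G.filter fun g => tsum P y g + (P g t₃ + P g t₄) = r g) = G.filter fun g => r g = tsum P y g₀ := by
    apply filter_congr
    intro g hg
    rw [hts g hg, htwin g hg t₃, htwin g hg t₄, hup, add_zero]
    exact eq_comm
  rw [e1, e2] at h
  exact h

end CommonStep

section Fibre

variable {N : ℕ}

/-- **DOUBLE-STEP LEMMA on a fibre of the game.**  On a perfect fibre, with four coins `i₁ ≠ i₂`, `i₃ ≠ i₄` of `x` such that the two
common-mode shifts `sdelta i₁ + sdelta i₂` and `sdelta i₃ + sdelta i₄` agree on every ACTIVE row other than `g`, and differ at the active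
row `g`, the test of `g` cannot pass at `x` shifted by the first pair. -/
theorem doubleStep_fibre (hN : 3 ≤ N) (β : Fin N → Fin N → ZMod 3) (c : Fin N → ZMod 3) (x : Fin N → Bool)
    (hodd : IsOdd x) (hperf : PerfectFibre β c (kline x)) {i₁ i₂ i₃ i₄ : Fin N} (h12 : i₁ ≠ i₂) (h34 : i₃ ≠ i₄)
    (hi1 : kline x i₁ = false) (hi2 : kline x i₂ = false) (hi3 : kline x i₃ = false) (hi4 : kline x i₄ = false)
    (g : Fin N) (hg : kline x g = true)
    (hU : ∀ b, kline x b = true → b ≠ g →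
      sdelta β x b i₁ + sdelta β x b i₂ = sdelta β x b i₃ + sdelta β x b i₄)
    (hne : sdelta β x g i₁ + sdelta β x g i₂ ≠ sdelta β x g i₃ + sdelta β x g i₄)
    (hpass : form β x g + (sdelta β x g i₁ + sdelta β x g i₂) = c g) : False := by
  obtain ⟨t₁, ht₁⟩ := exists_coinEmb_eq x (i := i₁) (mem_filter.2 ⟨mem_univ _, hi1⟩)
  obtain ⟨t₂, ht₂⟩ := exists_coinEmb_eq x (i := i₂) (mem_filter.2 ⟨mem_univ _, hi2⟩)
  obtain ⟨t₃, ht₃⟩ := exists_coinEmb_eq x (i := i₃) (mem_filter.2 ⟨mem_univ _, hi3⟩)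
  obtain ⟨t₄, ht₄⟩ := exists_coinEmb_eq x (i := i₄) (mem_filter.2 ⟨mem_univ _, hi4⟩)
  have ht12 : t₁ ≠ t₂ := fun h => h12 (by rw [← ht₁, ← ht₂, h])
  have ht34 : t₃ ≠ t₄ := fun h => h34 (by rw [← ht₃, ← ht₄, h])
  -- perfectness in test coordinates
  have hrel : ∀ y : Fin (coinsOf x).card → Bool, onesCard y % 2 = 0 →
      testCount (testMat β x) (testRhs β c x) (tauOf x) y % 2 = 0 := by
    intro y hy
    exact (rel_xOf_iff hN hodd hy).1 (hperf _ (isOdd_xOf hodd hy) (kline_xOf hN hodd hy))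
  set P := testMat β x with hP
  set r := testRhs β c x with hr
  have hPact : ∀ b t, kline x b = true → P b t = sdelta β x b (coinEmb x t) := by
    intro b t hb; simp [hP, testMat, hb]
  have hPin : ∀ b t, kline x b = false → P b t = 0 := by
    intro b t hb; simp [hP, testMat, hb]
  have hU' : ∀ b, b ≠ g → P b t₁ + P b t₂ = P b t₃ + P b t₄ := by
    intro b hb
    by_cases hact : kline x b = true
    · rw [hPact b t₁ hact, hPact b t₂ hact, hPact b t₃ hact, hPact b t₄ hact, ht₁, ht₂, ht₃, ht₄]
      exact hU b hact hb
    · have hf : kline x b = false := by simpa using hact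
      rw [hPin b t₁ hf, hPin b t₂ hf, hPin b t₃ hf, hPin b t₄ hf]
  have hne' : P g t₁ + P g t₂ ≠ P g t₃ + P g t₄ := by
    rw [hPact g t₁ hg, hPact g t₂ hg, hPact g t₃ hg, hPact g t₄ hg, ht₁, ht₂, ht₃, ht₄]; exact hne
  have hy0 : onesCard (fun _ : Fin (coinsOf x).card => false) % 2 = 0 := by
    unfold onesCard; simp
  have hts0 : tsum P (fun _ => false) g = 0 := by unfold tsum; simp
  have hpass' : tsum P (fun _ => false) g + (P g t₁ + P g t₂) = r g := by
    rw [hts0, zero_add, hPact g t₁ hg, hPact g t₂ hg, ht₁, ht₂]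
    simp only [hr, testRhs, hg, if_true]
    rw [← hpass]; ring
  exact doubleStep P r (tauOf x) ht12 ht34 g hU' hne' hrel (fun _ => false) hy0 rfl rfl rfl rfl hpass'

end Fibre

end Summit.QuantumAdvantage.AdviceFreeQNC0.AffBells36
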